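import Summits.Parity.GeneralizedHardyLittlewood.Theorems.GreenTaoLevelTwoGITwoQuadraticPhaseRungLemmas
import Summits.Parity.GeneralizedHardyLittlewood.Theorems.GreenTaoLevelTwoGITwoCyclicInverseBracketFunctions

/-!
# Route `GreenTaoLevelTwo`, crux `GITwo` (stmt-Parity-21275), line `birth`, stub `stub_cyclicInverse`:
# the Heisenberg bracket nilsequence `χ(αn) e(−c n [αn] + quadratic)` (GT08a arXiv Lemma 69, the
# Heisenberg part, over every box-comparable `H_d`)

Sixty-seventh helper file toward the XL stub `stub_cyclicInverse` (B. Green, T. Tao, *An inverse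
theorem for the Gowers `U³(G)` norm*, arXiv:math/0503014, Thm. 68 = PEMS 51 (2008) Thm. 12.8).
Block E16 (arXiv §12, proof of Lemma 69): "We are thus left with `χ(αn) e(½n(n+1)αqγ − [nα]nqγ)`.
But this can be generated from the Heisenberg shift (Example 64) with `x₀ = (0,0,0)`,
`F(x,y,z) := χ(x)e(y)` on `[−1/2,1/2] × (ℝ/ℤ)²` and `g = (1 0 qγ; 0 1 α; 0 0 1)`."  In the tree's
cube coordinates on `H³(ℝ)` (`Heis.mk x y z`, `(gh).z = g.z + h.z + g.x h.y`; the rung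
`…QuadraticPhaseRungLemmas` uses the right-`Γ`-invariant phase `z − x⌊y⌋` and the cutoff
`sin²(πy)`), the function is `Φ(x,y,z) = κ({y − ½}) · e(z − x⌊y⌋)` with a circle cutoff `κ`
vanishing near the seam (`…CircleCutoff`), and the orbit of `g = (c, α, β)` through `(0, ½, z₀)`
has `y = nα + ½`, so `⌊y⌋ = [nα]` (nearest integer) and `Φ(gⁿx₀) = κ({nα}) e(P(n) − c n [nα])`
with an explicit quadratic `P`.  Def-free:

* `hbk_mul_lattice`, `norm_hbk_le_one` — right-`Γ`-invariance and `1`-boundedness of `Φ`;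
* `norm_hbk_sub_le_boxGauge` — `‖Φ(g) − Φ(h)‖ ≤ (4π + L_κ + 2/(½ − r₂)) · S(gh⁻¹)` (box gauge);
* `norm_hbkF_sub_le_heisPreDist` — hence `Φ` descends to an `(4π + L_κ + 2/(½−r₂))`-Lipschitz
  function for the box pre-distance `ρ₀`, and `(…)·L`-Lipschitz for every box-comparable `d`;
* `heis_zpow` — coordinates of `gⁿ`, `n ∈ ℤ`;  `hbk_orbit` — the orbit formula for all `n ∈ ℤ`;
* `exists_heisenberg_bracket` — the packaged statement over `heisenbergWith d h`.

References: [GreenTao2008U3Inverse] arXiv:math/0503014, §12, Example 64 and proof of Lemma 69.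
-/

noncomputable section

namespace Summit.Parity.GeneralizedHardyLittlewood.GreenTaoLevelTwoGITwoCyclicInverse

open Literature.NumberTheory.Sieve
open Literature.NumberTheory.Sieve.GreenTaoLevelTwo
open Summit.Parity.GeneralizedHardyLittlewood.GreenTaoLevelTwoGITwoQuadraticPhaseRung
  (phase_mul_lattice exists_int_near_of_floor_ne)

/-- The phase `e(v) = toCircle(v mod 1)` is `1`-periodic in `v`. [folklore] -/
theorem toCircle_coe_add_int (v : ℝ) (k : ℤ) :
    ((AddCircle.toCircle ((v + k : ℝ) : AddCircle (1 : ℝ)) : Circle) : ℂ) =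
      ((AddCircle.toCircle ((v : ℝ) : AddCircle (1 : ℝ)) : Circle) : ℂ) := by
  congr 2
  rw [AddCircle.coe_add]
  have : ((k : ℝ) : AddCircle (1 : ℝ)) = 0 := by
    rw [AddCircle.coe_eq_zero_iff]; exact ⟨k, by simp⟩
  rw [this, add_zero]

/-- A point of `ℝ/ℤ` does not move under an integer shift of its representative. [folklore] -/
theorem coe_add_int_eq (v : ℝ) (k : ℤ) :
    ((v + k : ℝ) : AddCircle (1 : ℝ)) = ((v : ℝ) : AddCircle (1 : ℝ)) := by
  rw [AddCircle.coe_add]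
  have : ((k : ℝ) : AddCircle (1 : ℝ)) = 0 := by
    rw [AddCircle.coe_eq_zero_iff]; exact ⟨k, by simp⟩
  rw [this, add_zero]

section Phi

variable (κ : AddCircle (1 : ℝ) → ℝ)

/-- **`Φ` is right-`Γ`-invariant** (`Γ = H³(ℤ)`): `z − x⌊y⌋` moves by an integer and `y` by an
integer. [cite: GreenTao2008U3Inverse, §12, Example 64] -/
theorem hbk_mul_lattice (g γ : Heis) (hγ : γ ∈ Heis.latticeΓ) :
    (κ (((g * γ).y - 1 / 2 : ℝ) : AddCircle (1 : ℝ)) : ℂ) *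
        ((AddCircle.toCircle ((((g * γ).z - (g * γ).x * ⌊(g * γ).y⌋ : ℝ)) : AddCircle (1 : ℝ)) :
          Circle) : ℂ) =
      (κ ((g.y - 1 / 2 : ℝ) : AddCircle (1 : ℝ)) : ℂ) *
        ((AddCircle.toCircle (((g.z - g.x * ⌊g.y⌋ : ℝ)) : AddCircle (1 : ℝ)) : Circle) : ℂ) := by
  obtain ⟨k, hk⟩ := phase_mul_lattice g γ hγ
  obtain ⟨_, ⟨b, hb⟩, _⟩ := hγ
  rw [hk, toCircle_coe_add_int, Heis.y_mul, hb,
    show g.y + (b : ℝ) - 1 / 2 = (g.y - 1 / 2) + b by ring, coe_add_int_eq]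

/-- `‖Φ‖ ≤ 1`. [cite: GreenTao2008U3Inverse, §12, proof of Lemma 69] -/
theorem norm_hbk_le_one (hκ : ∀ a, 0 ≤ κ a ∧ κ a ≤ 1) (g : Heis) :
    ‖(κ ((g.y - 1 / 2 : ℝ) : AddCircle (1 : ℝ)) : ℂ) *
        ((AddCircle.toCircle (((g.z - g.x * ⌊g.y⌋ : ℝ)) : AddCircle (1 : ℝ)) : Circle) : ℂ)‖ ≤ 1 := by
  rw [norm_mul, Circle.norm_coe, mul_one, Complex.norm_real, Real.norm_eq_abs,
    abs_of_nonneg (hκ _).1]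
  exact (hκ _).2

/-- If `t` is within `S` of an integer then `{t − ½}` is at least `½ − S` away from `0` in `ℝ/ℤ`.
[folklore] -/
theorem half_sub_le_norm_coe_sub_half {t S : ℝ} {m : ℤ} (h : |t - m| ≤ S) :
    1 / 2 - S ≤ ‖((t - 1 / 2 : ℝ) : AddCircle (1 : ℝ))‖ := by
  rw [UnitAddCircle.norm_eq]
  set r : ℤ := round (t - 1 / 2) with hr
  -- `t − ½ − r = (t − m) − (j + ½)` with `j = r − m ∈ ℤ`, and `|j + ½| ≥ ½`
  have hhalf : (1 / 2 : ℝ) ≤ |((r - m : ℤ) : ℝ) + 1 / 2| := by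
    rcases le_or_gt 0 (r - m) with h0 | h0
    · have h1 : (0 : ℝ) ≤ ((r - m : ℤ) : ℝ) := by exact_mod_cast h0
      rw [abs_of_nonneg (by linarith)]
      linarith
    · have h1 : ((r - m : ℤ) : ℝ) ≤ -1 := by exact_mod_cast (show r - m ≤ -1 by omega)
      rw [abs_of_neg (by linarith)]
      linarith
  have e : t - 1 / 2 - (r : ℝ) = (t - m) - (((r - m : ℤ) : ℝ) + 1 / 2) := by push_cast; ring
  rw [e]
  have h2 := abs_sub_abs_le_abs_sub (((r - m : ℤ) : ℝ) + 1 / 2) (t - m)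
  rw [abs_sub_comm (((r - m : ℤ) : ℝ) + 1 / 2) (t - m)] at h2
  linarith

variable {κ} {r₂ Lκ : ℝ}

/-- **The Lipschitz estimate for `Φ` in the cube coordinates**:
`‖Φ(g) − Φ(h)‖ ≤ (4π + L_κ + 2/(½ − r₂)) · S(gh⁻¹)` (if `⌊y_g⌋ = ⌊y_h⌋` the phase moves by `≤ 2S`
and the cutoff by `≤ L_κ S`; otherwise both `y`'s are within `S` of an integer, where the cutoff
vanishes unless `S ≥ ½ − r₂`). [cite: GreenTao2008U3Inverse, §12, proof of Lemma 69] -/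
theorem norm_hbk_sub_le_boxGauge (hr : r₂ < 1 / 2) (hκ : ∀ a, 0 ≤ κ a ∧ κ a ≤ 1)
    (hκ0 : ∀ a, r₂ ≤ ‖a‖ → κ a = 0) (hκL : ∀ a b, |κ a - κ b| ≤ Lκ * dist a b) (hLκ : 0 ≤ Lκ)
    (g h : Heis) :
    ‖(κ ((g.y - 1 / 2 : ℝ) : AddCircle (1 : ℝ)) : ℂ) *
          ((AddCircle.toCircle (((g.z - g.x * ⌊g.y⌋ : ℝ)) : AddCircle (1 : ℝ)) : Circle) : ℂ) -
        (κ ((h.y - 1 / 2 : ℝ) : AddCircle (1 : ℝ)) : ℂ) *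
          ((AddCircle.toCircle (((h.z - h.x * ⌊h.y⌋ : ℝ)) : AddCircle (1 : ℝ)) : Circle) : ℂ)‖ ≤
      (4 * Real.pi + Lκ + 2 / (1 / 2 - r₂)) * boxGauge (g * h⁻¹) := by
  set S := boxGauge (g * h⁻¹) with hS
  have hS0 : 0 ≤ S := boxGauge_nonneg _
  have hπ := Real.pi_pos
  have hgap : 0 < 1 / 2 - r₂ := by linarith
  have hK : 0 ≤ 2 / (1 / 2 - r₂) := div_nonneg zero_le_two hgap.le
  -- the coordinates of `u = g h⁻¹`
  have ha : |g.x - h.x| ≤ S := by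
    have := abs_x_le_boxGauge (g * h⁻¹)
    rwa [Heis.x_mul, Heis.x_inv, ← sub_eq_add_neg] at this
  have hb : |g.y - h.y| ≤ S := by
    have := abs_y_le_boxGauge (g * h⁻¹)
    rwa [Heis.y_mul, Heis.y_inv, ← sub_eq_add_neg] at this
  have hc : |g.z - h.z - (g.x - h.x) * h.y| ≤ S := by
    have := abs_z_le_boxGauge (g * h⁻¹)
    rw [Heis.z_mul, Heis.z_inv, Heis.y_inv] at this
    have e : g.z + (-h.z + h.x * h.y) + g.x * -h.y = g.z - h.z - (g.x - h.x) * h.y := by ring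
    rwa [e] at this
  -- one-boundedness of the two values
  have h1g := norm_hbk_le_one κ hκ g
  have h1h := norm_hbk_le_one κ hκ h
  by_cases hk : ⌊g.y⌋ = ⌊h.y⌋
  · -- same integer part
    rw [hk]
    set k : ℤ := ⌊h.y⌋ with hkdef
    have hfl0 : (k : ℝ) ≤ h.y := Int.floor_le h.y
    have hfl1 : h.y < (k : ℝ) + 1 := Int.lt_floor_add_one h.y
    have hΔ : |(g.z - g.x * k) - (h.z - h.x * k)| ≤ 2 * S := by
      have e : (g.z - g.x * k) - (h.z - h.x * k) =
          (g.z - h.z - (g.x - h.x) * h.y) + (g.x - h.x) * (h.y - k) := by ring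
      rw [e]
      calc |(g.z - h.z - (g.x - h.x) * h.y) + (g.x - h.x) * (h.y - k)|
          ≤ |g.z - h.z - (g.x - h.x) * h.y| + |(g.x - h.x) * (h.y - k)| := abs_add_le _ _
        _ ≤ S + S * 1 := by
            rw [abs_mul]
            refine add_le_add hc (mul_le_mul ha ?_ (abs_nonneg _) hS0)
            rw [abs_le]; constructor <;> linarith
        _ = 2 * S := by ring
    have hcore := norm_kappa_mul_phase_sub_le hκ hκL hLκ (g.y - 1 / 2) (h.y - 1 / 2)
      (g.z - g.x * k) (h.z - h.x * k)
    refine hcore.trans ?_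
    rw [show g.y - 1 / 2 - (h.y - 1 / 2) = g.y - h.y by ring]
    have h2 : 2 * Real.pi * |(g.z - g.x * k) - (h.z - h.x * k)| ≤ 4 * Real.pi * S := by
      nlinarith [hΔ, abs_nonneg ((g.z - g.x * k) - (h.z - h.x * k))]
    have h3 : Lκ * |g.y - h.y| ≤ Lκ * S := mul_le_mul_of_nonneg_left hb hLκ
    nlinarith [h2, h3, hK, hS0]
  · -- different integer parts: both `y`'s are within `S` of an integer `m`
    obtain ⟨m, hgm, hhm⟩ := exists_int_near_of_floor_ne hk
    have hgS : |g.y - m| ≤ S := hgm.trans hb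
    have hhS : |h.y - m| ≤ S := hhm.trans hb
    by_cases hsmall : S < 1 / 2 - r₂
    · -- both cutoffs vanish
      have hκg : κ ((g.y - 1 / 2 : ℝ) : AddCircle (1 : ℝ)) = 0 :=
        hκ0 _ (by linarith [half_sub_le_norm_coe_sub_half hgS])
      have hκh : κ ((h.y - 1 / 2 : ℝ) : AddCircle (1 : ℝ)) = 0 :=
        hκ0 _ (by linarith [half_sub_le_norm_coe_sub_half hhS])
      rw [hκg, hκh]
      simp only [Complex.ofReal_zero, zero_mul, sub_zero, norm_zero]
      positivity
    · push Not at hsmall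
      have h2 : (2 : ℝ) ≤ 2 / (1 / 2 - r₂) * S := by
        rw [div_mul_eq_mul_div, le_div_iff₀ hgap]; nlinarith
      calc _ ≤ ‖(κ ((g.y - 1 / 2 : ℝ) : AddCircle (1 : ℝ)) : ℂ) *
              ((AddCircle.toCircle (((g.z - g.x * ⌊g.y⌋ : ℝ)) : AddCircle (1 : ℝ)) : Circle) : ℂ)‖ +
            ‖(κ ((h.y - 1 / 2 : ℝ) : AddCircle (1 : ℝ)) : ℂ) *
              ((AddCircle.toCircle (((h.z - h.x * ⌊h.y⌋ : ℝ)) : AddCircle (1 : ℝ)) : Circle) : ℂ)‖ :=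
            norm_sub_le _ _
        _ ≤ 2 := by linarith
        _ ≤ 2 / (1 / 2 - r₂) * S := h2
        _ ≤ (4 * Real.pi + Lκ + 2 / (1 / 2 - r₂)) * S := by nlinarith [hS0, hπ, hLκ]

/-- `F(gΓ) = Φ(g)`: the value through `Quotient.out` does not depend on the representative.
[cite: GreenTao2008U3Inverse, §12, Example 64] -/
theorem hbk_out_mk (g : Heis) :
    (κ (((Quotient.out (g : HX) : Heis).y - 1 / 2 : ℝ) : AddCircle (1 : ℝ)) : ℂ) *
        ((AddCircle.toCircle ((((Quotient.out (g : HX) : Heis).z -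
            (Quotient.out (g : HX) : Heis).x * ⌊(Quotient.out (g : HX) : Heis).y⌋ : ℝ)) :
              AddCircle (1 : ℝ)) : Circle) : ℂ) =
      (κ ((g.y - 1 / 2 : ℝ) : AddCircle (1 : ℝ)) : ℂ) *
        ((AddCircle.toCircle (((g.z - g.x * ⌊g.y⌋ : ℝ)) : AddCircle (1 : ℝ)) : Circle) : ℂ) := by
  obtain ⟨γ, hγ⟩ := QuotientGroup.mk_out_eq_mul Heis.latticeΓ g
  rw [hγ]
  exact hbk_mul_lattice κ g γ γ.2

/-- **`F` is Lipschitz for the box pre-distance `ρ₀`** with constant `4π + L_κ + 2/(½ − r₂)`.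
[cite: GreenTao2008U3Inverse, §12] [cite: GreenTao2012Nilmanifolds, Def. 2.2] -/
theorem norm_hbkF_sub_le_heisPreDist (hr : r₂ < 1 / 2) (hκ : ∀ a, 0 ≤ κ a ∧ κ a ≤ 1)
    (hκ0 : ∀ a, r₂ ≤ ‖a‖ → κ a = 0) (hκL : ∀ a b, |κ a - κ b| ≤ Lκ * dist a b) (hLκ : 0 ≤ Lκ)
    (p q : HX) :
    ‖(κ (((Quotient.out p : Heis).y - 1 / 2 : ℝ) : AddCircle (1 : ℝ)) : ℂ) *
          ((AddCircle.toCircle ((((Quotient.out p : Heis).z -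
              (Quotient.out p : Heis).x * ⌊(Quotient.out p : Heis).y⌋ : ℝ)) : AddCircle (1 : ℝ)) :
                Circle) : ℂ) -
        (κ (((Quotient.out q : Heis).y - 1 / 2 : ℝ) : AddCircle (1 : ℝ)) : ℂ) *
          ((AddCircle.toCircle ((((Quotient.out q : Heis).z -
              (Quotient.out q : Heis).x * ⌊(Quotient.out q : Heis).y⌋ : ℝ)) : AddCircle (1 : ℝ)) :
                Circle) : ℂ)‖ ≤
      (4 * Real.pi + Lκ + 2 / (1 / 2 - r₂)) * heisPreDist p q := by
  have hC : (0 : ℝ) < 4 * Real.pi + Lκ + 2 / (1 / 2 - r₂) := by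
    have : 0 < 1 / 2 - r₂ := by linarith
    positivity
  rw [← div_le_iff₀' hC]
  unfold heisPreDist
  refine le_ciInf fun γ => ?_
  rw [div_le_iff₀' hC]
  have h := norm_hbk_sub_le_boxGauge hr hκ hκ0 hκL hLκ (Quotient.out p * (γ : Heis)) (Quotient.out q)
  rwa [hbk_mul_lattice κ (Quotient.out p) γ γ.2] at h

end Phi

/-- **Coordinates of integer powers in `H³(ℝ)`**: `gⁿ = (n x, n y, n z + n(n−1)/2 · x y)` for all
`n ∈ ℤ`. [cite: GreenTao2010, §11, Example after Prop. 11.5] -/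
theorem heis_zpow (g : Heis) (n : ℤ) :
    (g ^ n).x = n * g.x ∧ (g ^ n).y = n * g.y ∧
      (g ^ n).z = n * g.z + ((n : ℝ) * (n - 1) / 2) * (g.x * g.y) := by
  obtain ⟨m, rfl | rfl⟩ := Int.eq_nat_or_neg n
  · obtain ⟨hx, hy, hz⟩ := heis_pow g m
    rw [zpow_natCast]
    exact ⟨by rw [hx]; push_cast; ring, by rw [hy]; push_cast; ring, by rw [hz]; push_cast; ring⟩
  · obtain ⟨hx, hy, hz⟩ := heis_pow g m
    rw [zpow_neg, zpow_natCast, Heis.x_inv, Heis.y_inv, Heis.z_inv, hx, hy, hz]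
    exact ⟨by push_cast; ring, by push_cast; ring, by push_cast; ring⟩

/-- **The orbit**: for `g = (c, α, β)` and `x₀ = (0, ½, z₀)`, the point `gⁿ x₀` (`n ∈ ℤ`) has
`y = nα + ½` (so `⌊y⌋ = ⌊nα + ½⌋`, the nearest integer to `nα`), `x = nc`, and
`z − x⌊y⌋ = z₀ + n(β + c/2 − cα/2) + n²(cα/2) − c n ⌊nα + ½⌋`; hence
`Φ(gⁿx₀) = κ({nα}) · e(z₀ + n(β + c/2 − cα/2) + n²(cα/2) − c n ⌊nα + ½⌋)`.
[cite: GreenTao2008U3Inverse, §12, Example 64 and proof of Lemma 69] -/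
theorem hbk_orbit (κ : AddCircle (1 : ℝ) → ℝ) (c α β z₀ : ℝ) (n : ℤ) :
    (κ ((((Heis.mk c α β) ^ n * Heis.mk 0 (1 / 2) z₀).y - 1 / 2 : ℝ) : AddCircle (1 : ℝ)) : ℂ) *
        ((AddCircle.toCircle (((((Heis.mk c α β) ^ n * Heis.mk 0 (1 / 2) z₀).z -
            ((Heis.mk c α β) ^ n * Heis.mk 0 (1 / 2) z₀).x *
              ⌊((Heis.mk c α β) ^ n * Heis.mk 0 (1 / 2) z₀).y⌋ : ℝ)) : AddCircle (1 : ℝ)) :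
                Circle) : ℂ) =
      (κ (((n * α : ℝ)) : AddCircle (1 : ℝ)) : ℂ) *
        ((AddCircle.toCircle (((z₀ + n * (β + c / 2 - c * α / 2) + (n : ℝ) ^ 2 * (c * α / 2) -
            c * n * ⌊(n : ℝ) * α + 1 / 2⌋ : ℝ)) : AddCircle (1 : ℝ)) : Circle) : ℂ) := by
  obtain ⟨hx, hy, hz⟩ := heis_zpow (Heis.mk c α β) n
  have key : ∀ u u' v v' : ℝ, u = u' → v = v' →
      (κ ((u : ℝ) : AddCircle (1 : ℝ)) : ℂ) *
          ((AddCircle.toCircle ((v : ℝ) : AddCircle (1 : ℝ)) : Circle) : ℂ) =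
        (κ ((u' : ℝ) : AddCircle (1 : ℝ)) : ℂ) *
          ((AddCircle.toCircle ((v' : ℝ) : AddCircle (1 : ℝ)) : Circle) : ℂ) := by
    intro u u' v v' hu hv; rw [hu, hv]
  rw [Heis.z_mul, Heis.x_mul, Heis.y_mul, hx, hy, hz]
  simp only [Heis.x_mk, Heis.y_mk, Heis.z_mk, add_zero]
  exact key _ _ _ _ (by ring) (by ring)

/-- The orbit read on the quotient `H³(ℝ)/H³(ℤ)` (through `Quotient.out`), all `n ∈ ℤ`.
[cite: GreenTao2008U3Inverse, §12, proof of Lemma 69] -/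
theorem hbkF_orbit (κ : AddCircle (1 : ℝ) → ℝ) (c α β z₀ : ℝ) (n : ℤ) :
    (κ (((Quotient.out ((Heis.mk c α β) ^ n • ((Heis.mk 0 (1 / 2) z₀ : Heis) : HX)) : Heis).y -
        1 / 2 : ℝ) : AddCircle (1 : ℝ)) : ℂ) *
        ((AddCircle.toCircle ((((Quotient.out ((Heis.mk c α β) ^ n •
            ((Heis.mk 0 (1 / 2) z₀ : Heis) : HX)) : Heis).z -
          (Quotient.out ((Heis.mk c α β) ^ n • ((Heis.mk 0 (1 / 2) z₀ : Heis) : HX)) : Heis).x *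
            ⌊(Quotient.out ((Heis.mk c α β) ^ n • ((Heis.mk 0 (1 / 2) z₀ : Heis) : HX)) :
              Heis).y⌋ : ℝ)) : AddCircle (1 : ℝ)) : Circle) : ℂ) =
      (κ (((n * α : ℝ)) : AddCircle (1 : ℝ)) : ℂ) *
        ((AddCircle.toCircle (((z₀ + n * (β + c / 2 - c * α / 2) + (n : ℝ) ^ 2 * (c * α / 2) -
            c * n * ⌊(n : ℝ) * α + 1 / 2⌋ : ℝ)) : AddCircle (1 : ℝ)) : Circle) : ℂ) := by
  rw [MulAction.Quotient.smul_coe, smul_eq_mul, hbk_out_mk, hbk_orbit]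

/-- **The Heisenberg bracket nilsequence over `H_d` (arXiv Lemma 69, Heisenberg part).**  For every
compatible metric `d` dominating the box pre-distance (`ρ₀ ≤ L·d`, e.g. box-comparable with
constant `L`), every circle cutoff `κ : ℝ/ℤ → [0,1]`
(`L_κ`-Lipschitz, vanishing on `‖a‖ ≥ r₂`, `r₂ < ½`) and all reals `c, α, β, z₀` there are a
`1`-bounded function `Φ` on `heisenbergWith d h`, Lipschitz with constant
`(4π + L_κ + 2/(½−r₂))·L` for `d`, an element `g` and a point `x₀` with
`Φ(gⁿ x₀) = κ({nα}) · e(z₀ + n(β + c/2 − cα/2) + n²(cα/2) − c n ⌊nα + ½⌋)` for all `n ∈ ℤ`.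
[cite: GreenTao2008U3Inverse, §12, proof of Lemma 69] -/
theorem exists_heisenberg_bracket (d : HX → HX → ℝ) (h : IsCompatMetric d) {L : ℝ}
    (hcomp : ∀ p q, heisPreDist p q ≤ L * d p q ∧ d p q ≤ L * heisPreDist p q)
    {κ : AddCircle (1 : ℝ) → ℝ} {r₂ Lκ : ℝ} (hr : r₂ < 1 / 2) (hκ : ∀ a, 0 ≤ κ a ∧ κ a ≤ 1)
    (hκ0 : ∀ a, r₂ ≤ ‖a‖ → κ a = 0) (hκL : ∀ a b, |κ a - κ b| ≤ Lκ * dist a b) (hLκ : 0 ≤ Lκ)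
    (c α β z₀ : ℝ) :
    ∃ (Φ : (heisenbergWith d h).G ⧸ (heisenbergWith d h).Γ → ℂ) (g : (heisenbergWith d h).G)
      (x₀ : (heisenbergWith d h).G ⧸ (heisenbergWith d h).Γ),
      (∀ y, ‖Φ y‖ ≤ 1) ∧
      (∀ y z, ‖Φ y - Φ z‖ ≤ ((4 * Real.pi + Lκ + 2 / (1 / 2 - r₂)) * L) * (heisenbergWith d h).dist y z) ∧
      ∀ n : ℤ, Φ (g ^ n • x₀) =
        (κ (((n * α : ℝ)) : AddCircle (1 : ℝ)) : ℂ) *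
          ((AddCircle.toCircle (((z₀ + n * (β + c / 2 - c * α / 2) + (n : ℝ) ^ 2 * (c * α / 2) -
              c * n * ⌊(n : ℝ) * α + 1 / 2⌋ : ℝ)) : AddCircle (1 : ℝ)) : Circle) : ℂ) := by
  refine ⟨fun p : HX => (κ (((Quotient.out p : Heis).y - 1 / 2 : ℝ) : AddCircle (1 : ℝ)) : ℂ) *
      ((AddCircle.toCircle ((((Quotient.out p : Heis).z -
          (Quotient.out p : Heis).x * ⌊(Quotient.out p : Heis).y⌋ : ℝ)) : AddCircle (1 : ℝ)) :
            Circle) : ℂ),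
    (Heis.mk c α β : Heis), ((Heis.mk 0 (1 / 2) z₀ : Heis) : HX),
    fun p => norm_hbk_le_one κ hκ _, fun p q => ?_, fun n => ?_⟩
  · calc _ ≤ (4 * Real.pi + Lκ + 2 / (1 / 2 - r₂)) * heisPreDist p q :=
          norm_hbkF_sub_le_heisPreDist hr hκ hκ0 hκL hLκ p q
      _ ≤ (4 * Real.pi + Lκ + 2 / (1 / 2 - r₂)) * (L * d p q) := by
          have : 0 < 1 / 2 - r₂ := by linarith
          exact mul_le_mul_of_nonneg_left (hcomp p q).1 (by positivity)
      _ = ((4 * Real.pi + Lκ + 2 / (1 / 2 - r₂)) * L) * (heisenbergWith d h).dist p q := by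
          show _ = ((4 * Real.pi + Lκ + 2 / (1 / 2 - r₂)) * L) * d p q
          ring
  · exact hbkF_orbit κ c α β z₀ n

end Summit.Parity.GeneralizedHardyLittlewood.GreenTaoLevelTwoGITwoCyclicInverse
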